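import Literature.AlgebraicGeometry.Motives.HodgeThetaAnnihilatorTimesRigidSymplectic
import Literature.AlgebraicGeometry.Motives.HodgeLieSemisimpleTimesAbelian
import Literature.AlgebraicGeometry.Motives.HodgeStructureWeil
import HarnessLib

/-!
# `𝔥(H₁ ⊕ H₂) = 𝔥(H₁) × 𝔰𝔭(V₂, ψ₂)` when `H₂` is GENERIC OF RANK `2`, `4` OR `6` (`End_Hdg(H₂) = ℚ`: a non-CM curve, a surface or a threefold
# with `End⁰ = ℚ`) and `Hom_Hdg(H₂, H₁) = 0` (Moonen–Zarhin 1999 Lemma (3.4) with (2.4)(3), for the Lie algebra `hodgeLie` itself)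

Family `hodge`, layer `Literature/AlgebraicGeometry/Motives`; THEOREMS ONLY (no definition, no named fact).  Written for the cell
`pub-hodgecm2` (COR-CM), seat `b27` gen 47 (count-neutral Mumford–Tate-rank ladder); companion of `Motives/HodgeLieTimesNonCMCurve` (rank `2`).
The tree's `HodgeThetaAnnihilatorTimesRigidSymplectic` (cell `pub-hodge-ring2`) proves Moonen–Zarhin's Lemma (3.4) for a RIGID SYMPLECTIC second
factor — «`Hg(X₁ × X₂) = Hg(X₁) × Hg(X₂)` or `Hom(X₂, X₁) ≠ 0`» — as the abstract statement `goursat_incl_corner_mem_of_hom_eq_zero_of_rigid`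
about ANY bracket-closed rational `𝔞 ⊆ End(V₁ ⊕ V₂)` commuting with the two projectors, with `ψ_i`-skew corners and `Θ ∈ 𝔞_ℂ`; rigidity of
`V₂` of rank `2`, `4`, `6` with `End_Hdg = ℚ` is the tree's `LowRankGeneric.mem_spanC_of_skew` (`RankTwoTheta`, `SymplecticTheta`,
`SymplecticThetaSix`: `hg = 𝔰𝔭_{2g}`, MZ99 (2.4)(3)).  HERE it is applied to `𝔞 = 𝔥(H)`, the Lie algebra of the Hodge group, giving:

* **`block_incl₂_skewAdjoint_of_lowRankGeneric_summand`** — for `H ≅ H₁ ⊕ H₂` (morphisms `ι_i`, `π_i` with `π_i ι_i = id`,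
  `ι₁ π₁ + ι₂ π₂ = id`) of effective weight-one polarizable Hodge structures with `dim V₂ ∈ {2, 4, 6}`, `End_Hdg(H₂) = ℚ` and no non-zero
  `ℚ`-linear `V₂ → V₁` respecting the Hodge pieces: `𝔥(H)` is block diagonal and contains `ι₂ 𝔰𝔭(V₂, ψ₂) π₂`;
  and `𝔥(H₂) = 𝔰𝔭(V₂, ψ₂)` (`Hg = Sp_{2g}`, read off the product);
* **`finrank_hodgeLie_eq_add_finrank_skewAdjoint_of_lowRankGeneric_summand`** — `dim_ℚ 𝔥(H) = dim_ℚ 𝔥(H₁) + dim 𝔰𝔭(V₂, ψ₂)`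
  (`+ 3`, `+ 10`, `+ 21`).
No hypothesis on `H₁` (`X₁` ARBITRARY).  AV reading: `CorCM/MumfordTateRankTimesLowGeneric` (`t(A × S) + 1 = t(A) + t(S)` for `S` of dimension
`≤ 3` with `End⁰S = ℚ` and `Hom(A, S) = 0`).

## References
* [MoonenZarhin1999LowDim] B. Moonen, Yu. G. Zarhin, *Hodge classes on abelian varieties of low dimension*, Math. Ann. 315 (1999),
  §2 (2.4)(3), §3 (3.1), Lemma (3.3), Lemma (3.4), §5 (5.4) [corpus: paper:arxiv-math_9901113 pp. 5–7].
  [cite: MoonenZarhin1999LowDim, §3 Lemma (3.4)]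
* [Deligne1982HodgeCycles] P. Deligne, LNM 900 (1982), I §3.1 and Prop. 3.4. [cite: Deligne1982HodgeCycles, I §3.1 and Prop. 3.4]
-/

noncomputable section

namespace Literature.AlgebraicGeometry.Motives

namespace HodgeStructure

universe u

variable {V₁ : Type u} [AddCommGroup V₁] [Module ℚ V₁] [Module.Finite ℚ V₁]
  {V₂ : Type u} [AddCommGroup V₂] [Module ℚ V₂] [Module.Finite ℚ V₂]
  {V : Type u} [AddCommGroup V] [Module ℚ V] [Module.Finite ℚ V] [HodgeTensorFacts.{u, u}] {n : ℤ}
  {H₁ : HodgeStructure V₁ n} {H₂ : HodgeStructure V₂ n} {H : HodgeStructure V n}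
  (ι₁ : Hom H₁ H) (π₁ : Hom H H₁) (ι₂ : Hom H₂ H) (π₂ : Hom H H₂)
  (hπι₁ : ∀ v, π₁.toLinearMap (ι₁.toLinearMap v) = v) (hπι₂ : ∀ v, π₂.toLinearMap (ι₂.toLinearMap v) = v)
  (hsum : ∀ v, ι₁.toLinearMap (π₁.toLinearMap v) + ι₂.toLinearMap (π₂.toLinearMap v) = v)
  (hn : n = 1) (heff₁ : H₁.IsEffective) (heff₂ : H₂.IsEffective) (ψ₁ : H₁.Polarization) (ψ₂ : H₂.Polarization)
  (hE₂ : ∀ a ∈ H₂.endAlg, ∃ x : ℚ, a = x • 1) (hV₂ : Module.finrank ℚ V₂ = 2 ∨ Module.finrank ℚ V₂ = 4 ∨ Module.finrank ℚ V₂ = 6)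
  (hHom : ∀ f : V₂ →ₗ[ℚ] V₁, (∀ p, ∀ x ∈ H₂.piece p (n - p), f.baseChange ℂ x ∈ H₁.piece p (n - p)) → f = 0)

omit [Module.Finite ℚ V₁] [Module.Finite ℚ V₂] [Module.Finite ℚ V] [HodgeTensorFacts.{u, u}] in
include hπι₁ hπι₂ hsum in
/-- `π₂ ι₁ = 0` for a decomposition `ι₁ π₁ + ι₂ π₂ = id` with `π_i ι_i = id`. [folklore] -/
private theorem proj₂_incl₁_eq_zero' (v : V₁) : π₂.toLinearMap (ι₁.toLinearMap v) = 0 := by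
  have h := congrArg π₂.toLinearMap (hsum (ι₁.toLinearMap v))
  rw [map_add, hπι₁ v, hπι₂] at h
  exact add_eq_left.1 h

omit [Module.Finite ℚ V₁] [Module.Finite ℚ V₂] [Module.Finite ℚ V] [HodgeTensorFacts.{u, u}] in
include hπι₁ hπι₂ hsum in
/-- `π₁ ι₂ = 0` for a decomposition `ι₁ π₁ + ι₂ π₂ = id` with `π_i ι_i = id`. [folklore] -/
private theorem proj₁_incl₂_eq_zero' (v : V₂) : π₁.toLinearMap (ι₂.toLinearMap v) = 0 := by
  have h := congrArg π₁.toLinearMap (hsum (ι₂.toLinearMap v))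
  rw [map_add, hπι₂ v, hπι₁] at h
  exact add_eq_left.1 h

include hπι₁ hπι₂ hsum hn heff₁ heff₂ ψ₁ ψ₂ hE₂ hV₂ hHom in
/-- **Moonen–Zarhin Lemma (3.4) for `𝔥(H)`, rigid symplectic summand: `𝔥(H)` is block diagonal for `e₁ = ι₁ π₁` and contains
`0 ⊕ 𝔰𝔭(V₂, ψ₂)`** when `H₂` is generic of rank `2`, `4` or `6` with `Hom_Hdg(H₂, H₁) = 0` — the tree's
`goursat_incl_corner_mem_of_hom_eq_zero_of_rigid` applied to `𝔞 = 𝔥(H)`, with rigidity `LowRankGeneric.mem_spanC_of_skew`.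
[cite: MoonenZarhin1999LowDim, §2 (2.4) and §3 Lemma (3.4)] [cite: Deligne1982HodgeCycles, I §3.1 and Prop. 3.4] -/
private theorem block_and_incl₂_mem_hodgeLie_of_lowRankGeneric_summand' :
    (∀ X ∈ H.hodgeLie, ι₁.toLinearMap ∘ₗ (π₁.toLinearMap ∘ₗ X ∘ₗ ι₁.toLinearMap) ∘ₗ π₁.toLinearMap ∈ H.hodgeLie) ∧
      ∀ Z₂ : Module.End ℚ V₂, (∀ v w, ψ₂.form (Z₂ v) w + ψ₂.form v (Z₂ w) = 0) →
        ι₂.toLinearMap ∘ₗ Z₂ ∘ₗ π₂.toLinearMap ∈ H.hodgeLie := by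
  classical
  -- the presentation as linear-map identities
  have hπι₁' : π₁.toLinearMap ∘ₗ ι₁.toLinearMap = LinearMap.id := LinearMap.ext hπι₁
  have hπι₂' : π₂.toLinearMap ∘ₗ ι₂.toLinearMap = LinearMap.id := LinearMap.ext hπι₂
  have hπ₁ι₂ : π₁.toLinearMap ∘ₗ ι₂.toLinearMap = 0 := LinearMap.ext (proj₁_incl₂_eq_zero' ι₁ π₁ ι₂ π₂ hπι₁ hπι₂ hsum)
  have hπ₂ι₁ : π₂.toLinearMap ∘ₗ ι₁.toLinearMap = 0 := LinearMap.ext (proj₂_incl₁_eq_zero' ι₁ π₁ ι₂ π₂ hπι₁ hπι₂ hsum)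
  have hsum' : ι₁.toLinearMap ∘ₗ π₁.toLinearMap + ι₂.toLinearMap ∘ₗ π₂.toLinearMap = LinearMap.id := LinearMap.ext hsum
  -- Hodge pieces and Hodge operators
  have hι₁F : ∀ p, ∀ x ∈ H₁.piece p (n - p), ι₁.toLinearMap.baseChange ℂ x ∈ H.piece p (n - p) :=
    fun p x hx => ι₁.map_piece_le p _ ⟨x, hx, rfl⟩
  have hι₂F : ∀ p, ∀ x ∈ H₂.piece p (n - p), ι₂.toLinearMap.baseChange ℂ x ∈ H.piece p (n - p) :=
    fun p x hx => ι₂.map_piece_le p _ ⟨x, hx, rfl⟩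
  obtain ⟨ΘU, hΘU⟩ := exists_hodgeTheta H
  obtain ⟨Θ₁, hΘ₁⟩ := exists_hodgeTheta H₁
  obtain ⟨Θ₂, hΘ₂⟩ := exists_hodgeTheta H₂
  have hΘ𝔞 : ΘU ∈ spanC H.hodgeLie := (hodgeLieC_eq_spanC H) ▸ H.mem_hodgeLieC_of_forall_piece hΘU
  have hΘι₁ := theta_incl_eq H H₁ hι₁F hΘU hΘ₁
  have hΘι₂ := theta_incl_eq H H₂ hι₂F hΘU hΘ₂
  -- `𝔥(H)`: bracket-closed, commutes with the projectors, skew corners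
  have hbr : ∀ X ∈ H.hodgeLie, ∀ X' ∈ H.hodgeLie, X * X' - X' * X ∈ H.hodgeLie := fun X hX X' hX' =>
    H.commutator_mem_hodgeLie hX hX'
  have hP₁ : ∀ X ∈ H.hodgeLie, X * (ι₁.toLinearMap ∘ₗ π₁.toLinearMap) = (ι₁.toLinearMap ∘ₗ π₁.toLinearMap) * X :=
    fun X hX => commute_of_mem_hodgeLie H hX ⟨_, Hom.toLinearMap_mem_endAlg (ι₁.comp π₁)⟩
  have hP₂ : ∀ X ∈ H.hodgeLie, X * (ι₂.toLinearMap ∘ₗ π₂.toLinearMap) = (ι₂.toLinearMap ∘ₗ π₂.toLinearMap) * X :=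
    fun X hX => commute_of_mem_hodgeLie H hX ⟨_, Hom.toLinearMap_mem_endAlg (ι₂.comp π₂)⟩
  have hskew₁ : ∀ X ∈ H.hodgeLie, ∀ v w, ψ₁.form ((π₁.toLinearMap ∘ₗ X ∘ₗ ι₁.toLinearMap) v) w +
      ψ₁.form v ((π₁.toLinearMap ∘ₗ X ∘ₗ ι₁.toLinearMap) w) = 0 :=
    fun X hX => form_apply_add_eq_zero_of_mem_hodgeLie ψ₁ (comp_mem_hodgeLie_of_retract ι₁ π₁ hπι₁ hX)
  have hskew₂ : ∀ X ∈ H.hodgeLie, ∀ v w, ψ₂.form ((π₂.toLinearMap ∘ₗ X ∘ₗ ι₂.toLinearMap) v) w +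
      ψ₂.form v ((π₂.toLinearMap ∘ₗ X ∘ₗ ι₂.toLinearMap) w) = 0 :=
    fun X hX => form_apply_add_eq_zero_of_mem_hodgeLie ψ₂ (comp_mem_hodgeLie_of_retract ι₂ π₂ hπι₂ hX)
  -- `Hom_Hdg(H₂, H₁) = 0` in `Θ`-form
  have hHom' : ∀ f : V₂ →ₗ[ℚ] V₁, Θ₁ ∘ₗ f.baseChange ℂ = f.baseChange ℂ ∘ₗ Θ₂ → f = 0 := fun f hf =>
    eq_zero_of_theta_comp_eq_of_hom_eq_zero hn H₁ H₂ heff₁ heff₂ hΘ₁ hΘ₂ hHom hf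
  exact goursat_incl_corner_mem_of_hom_eq_zero_of_rigid hn H₁ H₂ heff₁ heff₂ hπι₁' hπι₂' hπ₁ι₂ hπ₂ι₁ hsum' H.hodgeLie hbr hP₁ hP₂
    ψ₁ ψ₂ hskew₁ hskew₂ (by rcases hV₂ with h | h | h <;> omega) hΘ₁ hΘ₂
    (fun 𝔤₂ hbr₂ hskew₂' hΘ𝔤 Y hY => LowRankGeneric.mem_spanC_of_skew H₂ hn heff₂ ψ₂ hE₂ hV₂ hΘ₂ 𝔤₂ hbr₂ hskew₂' hΘ𝔤 Y hY)
    hΘ𝔞 hΘι₁ hΘι₂ hHom'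

include hπι₁ hπι₂ hsum hn heff₁ heff₂ ψ₁ ψ₂ hE₂ hV₂ hHom in
/-- **`𝔥(H₁ ⊕ H₂) = 𝔥(H₁) × 𝔥(H₂)` for a generic low-rank summand `H₂` with `Hom_Hdg(H₂, H₁) = 0`:** `X ∈ 𝔥(H)` iff
`X = ι₁ Y₁ π₁ + ι₂ Y₂ π₂` with `Y₁ ∈ 𝔥(H₁)`, `Y₂ ∈ 𝔥(H₂)` (`⟹`: diagonal blocks, `Motives/HodgeLieDirectSum`; `⟸`: block diagonality gives
`ι₁ 𝔥(H₁) π₁ ⊆ 𝔥(H)` by `comp_mem_hodgeLie_of_block`, and `ι₂ 𝔥(H₂) π₂ ⊆ 𝔥(H)` because `𝔥(H₂)` is `ψ₂`-skew).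
[cite: MoonenZarhin1999LowDim, §3 Lemma (3.4)] [cite: Deligne1982HodgeCycles, I §3.1 and Prop. 3.4] -/
private theorem mem_hodgeLie_iff_of_lowRankGeneric_summand (X : Module.End ℚ V) :
    X ∈ H.hodgeLie ↔ ∃ Y₁ ∈ H₁.hodgeLie, ∃ Y₂ ∈ H₂.hodgeLie,
      X = ι₁.toLinearMap ∘ₗ Y₁ ∘ₗ π₁.toLinearMap + ι₂.toLinearMap ∘ₗ Y₂ ∘ₗ π₂.toLinearMap := by
  obtain ⟨h1, h2⟩ := block_and_incl₂_mem_hodgeLie_of_lowRankGeneric_summand' ι₁ π₁ ι₂ π₂ hπι₁ hπι₂ hsum hn heff₁ heff₂ ψ₁ ψ₂ hE₂ hV₂ hHom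
  -- block diagonality in the form `e₁ X ∈ 𝔥(H)`
  have hblock : ∀ X ∈ H.hodgeLie, (ι₁.toLinearMap ∘ₗ π₁.toLinearMap) ∘ₗ X ∈ H.hodgeLie := by
    intro X hX
    have heq : (ι₁.toLinearMap ∘ₗ π₁.toLinearMap) ∘ₗ X =
        ι₁.toLinearMap ∘ₗ (π₁.toLinearMap ∘ₗ X ∘ₗ ι₁.toLinearMap) ∘ₗ π₁.toLinearMap := by
      have h := eq_sum_blocks_of_mem_hodgeLie ι₁ π₁ ι₂ π₂ hπι₁ hπι₂ hsum hX
      refine LinearMap.ext fun v => ?_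
      conv_lhs => rw [h]
      simp only [LinearMap.comp_apply, LinearMap.add_apply, map_add, hπι₁,
        proj₁_incl₂_eq_zero' ι₁ π₁ ι₂ π₂ hπι₁ hπι₂ hsum, map_zero, add_zero]
    rw [heq]
    exact h1 X hX
  constructor
  · intro hX
    exact ⟨_, comp_mem_hodgeLie_of_retract ι₁ π₁ hπι₁ hX, _, comp_mem_hodgeLie_of_retract ι₂ π₂ hπι₂ hX,
      eq_sum_blocks_of_mem_hodgeLie ι₁ π₁ ι₂ π₂ hπι₁ hπι₂ hsum hX⟩
  · rintro ⟨Y₁, hY₁, Y₂, hY₂, rfl⟩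
    exact Submodule.add_mem _ (comp_mem_hodgeLie_of_block ι₁ π₁ hπι₁ hblock hY₁)
      (h2 Y₂ (form_apply_add_eq_zero_of_mem_hodgeLie ψ₂ hY₂))

include hπι₁ hπι₂ hsum hn heff₁ heff₂ ψ₁ hE₂ hV₂ hHom in
/-- **`𝔥(H₂) = 𝔰𝔭(V₂, ψ₂)` for the generic low-rank summand** (`Hg = Sp_{2g}`, `g ≤ 3`, Moonen–Zarhin (2.4)), read off the product:
`ι₂ Z π₂ ∈ 𝔥(H)` for every `ψ₂`-skew `Z`, and `π₂ 𝔥(H) ι₂ ⊆ 𝔥(H₂) ⊆ 𝔰𝔭(V₂, ψ₂)`. [cite: MoonenZarhin1999LowDim, §2 (2.4) and §3 Lemma (3.4)] -/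
private theorem hodgeLie_eq_skewAdjoint_of_lowRankGeneric_summand' : H₂.hodgeLie = ψ₂.form.skewAdjointSubmodule := by
  obtain ⟨-, h2⟩ := block_and_incl₂_mem_hodgeLie_of_lowRankGeneric_summand' ι₁ π₁ ι₂ π₂ hπι₁ hπι₂ hsum hn heff₁ heff₂ ψ₁ ψ₂ hE₂ hV₂ hHom
  ext Y
  rw [LinearMap.mem_skewAdjointSubmodule]
  refine ⟨fun h v w => ?_, fun h => ?_⟩
  · rw [Pi.neg_apply, map_neg, ← add_eq_zero_iff_eq_neg]
    exact form_apply_add_eq_zero_of_mem_hodgeLie ψ₂ h v w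
  · have hskew : ∀ v w, ψ₂.form (Y v) w + ψ₂.form v (Y w) = 0 := fun v w => by
      have h' := h v w
      rw [Pi.neg_apply, map_neg, ← add_eq_zero_iff_eq_neg] at h'
      exact h'
    have hmem := comp_mem_hodgeLie_of_retract ι₂ π₂ hπι₂ (h2 Y hskew)
    have heq : π₂.toLinearMap ∘ₗ (ι₂.toLinearMap ∘ₗ Y ∘ₗ π₂.toLinearMap) ∘ₗ ι₂.toLinearMap = Y := by
      refine LinearMap.ext fun v => ?_
      simp only [LinearMap.comp_apply, hπι₂]
    rwa [heq] at hmem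

include hπι₁ hπι₂ hsum hn heff₁ heff₂ ψ₁ ψ₂ hE₂ hV₂ hHom in
/-- **`dim_ℚ 𝔥(H₁ ⊕ H₂) = dim_ℚ 𝔥(H₁) + dim_ℚ 𝔰𝔭(V₂, ψ₂)` for a generic low-rank summand `H₂` with `Hom_Hdg(H₂, H₁) = 0`** (`+ 3`, `+ 10`,
`+ 21`: Moonen–Zarhin Lemma (3.4), `Hg(X₁ × X₂) = Hg(X₁) × Sp_{2g}`, in dimensions).  The block map `(Y₁, Y₂) ↦ ι₁ Y₁ π₁ + ι₂ Y₂ π₂` is a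
linear bijection `𝔥(H₁) × 𝔥(H₂) ≅ 𝔥(H)` and `𝔥(H₂) = 𝔰𝔭(V₂, ψ₂)`. [cite: MoonenZarhin1999LowDim, §2 (2.4) and §3 Lemma (3.4)]
[cite: Deligne1982HodgeCycles, I §3.1 and Prop. 3.4] -/
theorem finrank_hodgeLie_eq_add_finrank_skewAdjoint_of_lowRankGeneric_summand :
    Module.finrank ℚ H.hodgeLie = Module.finrank ℚ H₁.hodgeLie + Module.finrank ℚ ψ₂.form.skewAdjointSubmodule := by
  rw [← hodgeLie_eq_skewAdjoint_of_lowRankGeneric_summand' ι₁ π₁ ι₂ π₂ hπι₁ hπι₂ hsum hn heff₁ heff₂ ψ₁ ψ₂ hE₂ hV₂ hHom]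
  have hiff := mem_hodgeLie_iff_of_lowRankGeneric_summand ι₁ π₁ ι₂ π₂ hπι₁ hπι₂ hsum hn heff₁ heff₂ ψ₁ ψ₂ hE₂ hV₂ hHom
  let Φ : (H₁.hodgeLie × H₂.hodgeLie) →ₗ[ℚ] H.hodgeLie :=
    { toFun := fun Y => ⟨ι₁.toLinearMap ∘ₗ (Y.1 : Module.End ℚ V₁) ∘ₗ π₁.toLinearMap +
          ι₂.toLinearMap ∘ₗ (Y.2 : Module.End ℚ V₂) ∘ₗ π₂.toLinearMap, (hiff _).2 ⟨_, Y.1.2, _, Y.2.2, rfl⟩⟩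
      map_add' := fun Y Z => Subtype.ext (by
        simp only [Prod.fst_add, Prod.snd_add, Submodule.coe_add, LinearMap.comp_add, LinearMap.add_comp]
        abel)
      map_smul' := fun c Y => Subtype.ext (by
        simp only [Prod.smul_fst, Prod.smul_snd, Submodule.coe_smul, LinearMap.comp_smul, LinearMap.smul_comp,
          RingHom.id_apply, smul_add]) }
  have hΦ : ∀ Y : H₁.hodgeLie × H₂.hodgeLie, ((Φ Y : H.hodgeLie) : Module.End ℚ V) =
      ι₁.toLinearMap ∘ₗ (Y.1 : Module.End ℚ V₁) ∘ₗ π₁.toLinearMap +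
        ι₂.toLinearMap ∘ₗ (Y.2 : Module.End ℚ V₂) ∘ₗ π₂.toLinearMap := fun _ => rfl
  have hb₁ : ∀ (Y₁ : Module.End ℚ V₁) (Y₂ : Module.End ℚ V₂),
      π₁.toLinearMap ∘ₗ (ι₁.toLinearMap ∘ₗ Y₁ ∘ₗ π₁.toLinearMap + ι₂.toLinearMap ∘ₗ Y₂ ∘ₗ π₂.toLinearMap) ∘ₗ
        ι₁.toLinearMap = Y₁ := fun Y₁ Y₂ => by
    refine LinearMap.ext fun v => ?_
    simp only [LinearMap.comp_apply, LinearMap.add_apply, hπι₁,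
      proj₂_incl₁_eq_zero' ι₁ π₁ ι₂ π₂ hπι₁ hπι₂ hsum, map_zero, add_zero]
  have hb₂ : ∀ (Y₁ : Module.End ℚ V₁) (Y₂ : Module.End ℚ V₂),
      π₂.toLinearMap ∘ₗ (ι₁.toLinearMap ∘ₗ Y₁ ∘ₗ π₁.toLinearMap + ι₂.toLinearMap ∘ₗ Y₂ ∘ₗ π₂.toLinearMap) ∘ₗ
        ι₂.toLinearMap = Y₂ := fun Y₁ Y₂ => by
    refine LinearMap.ext fun v => ?_
    simp only [LinearMap.comp_apply, LinearMap.add_apply, hπι₂, map_zero,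
      proj₁_incl₂_eq_zero' ι₁ π₁ ι₂ π₂ hπι₁ hπι₂ hsum, zero_add]
  have hinj : Function.Injective Φ := fun Y Z hYZ => by
    have h := congrArg (fun W : H.hodgeLie => (W : Module.End ℚ V)) hYZ
    simp only [hΦ] at h
    refine Prod.ext (Subtype.ext ?_) (Subtype.ext ?_)
    · rw [← hb₁ (Y.1 : Module.End ℚ V₁) (Y.2 : Module.End ℚ V₂), h, hb₁]
    · rw [← hb₂ (Y.1 : Module.End ℚ V₁) (Y.2 : Module.End ℚ V₂), h, hb₂]
  have hsurj : Function.Surjective Φ := fun W => by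
    obtain ⟨Y₁, hY₁, Y₂, hY₂, hW⟩ := (hiff _).1 W.2
    exact ⟨(⟨Y₁, hY₁⟩, ⟨Y₂, hY₂⟩), Subtype.ext (by rw [hΦ]; exact hW.symm)⟩
  rw [← (LinearEquiv.ofBijective Φ ⟨hinj, hsurj⟩).finrank_eq, Module.finrank_prod]

include hπι₁ hπι₂ hsum hn heff₁ heff₂ ψ₁ ψ₂ hE₂ hV₂ hHom in
/-- **Moonen–Zarhin Lemma (3.4) for `𝔥(H)` with a generic summand of rank `2`, `4` or `6`** (`End_Hdg(H₂) = ℚ`, `Hom_Hdg(H₂, H₁) = 0`, `H₁`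
arbitrary): (1) `𝔥(H)` is block diagonal for `e₁ = ι₁ π₁`; (2) `ι₂ Z π₂ ∈ 𝔥(H)` for every `ψ₂`-skew `Z` («`Hg(X₁ × X₂) ⊇ 1 × Sp_{2g}`»); (3)
`𝔥(H₂) = 𝔰𝔭(V₂, ψ₂)` («`Hg(X₂) = Sp_{2g}`», MZ99 (2.4)). [cite: MoonenZarhin1999LowDim, §2 (2.4) and §3 Lemma (3.4)]
[cite: Deligne1982HodgeCycles, I §3.1 and Prop. 3.4] -/
theorem block_incl₂_skewAdjoint_of_lowRankGeneric_summand :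
    (∀ X ∈ H.hodgeLie, ι₁.toLinearMap ∘ₗ (π₁.toLinearMap ∘ₗ X ∘ₗ ι₁.toLinearMap) ∘ₗ π₁.toLinearMap ∈ H.hodgeLie) ∧
      (∀ Z₂ : Module.End ℚ V₂, (∀ v w, ψ₂.form (Z₂ v) w + ψ₂.form v (Z₂ w) = 0) →
        ι₂.toLinearMap ∘ₗ Z₂ ∘ₗ π₂.toLinearMap ∈ H.hodgeLie) ∧
      H₂.hodgeLie = ψ₂.form.skewAdjointSubmodule :=
  ⟨(block_and_incl₂_mem_hodgeLie_of_lowRankGeneric_summand' ι₁ π₁ ι₂ π₂ hπι₁ hπι₂ hsum hn heff₁ heff₂ ψ₁ ψ₂ hE₂ hV₂ hHom).1,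
    (block_and_incl₂_mem_hodgeLie_of_lowRankGeneric_summand' ι₁ π₁ ι₂ π₂ hπι₁ hπι₂ hsum hn heff₁ heff₂ ψ₁ ψ₂ hE₂ hV₂ hHom).2,
    hodgeLie_eq_skewAdjoint_of_lowRankGeneric_summand' ι₁ π₁ ι₂ π₂ hπι₁ hπι₂ hsum hn heff₁ heff₂ ψ₁ ψ₂ hE₂ hV₂ hHom⟩

end HodgeStructure

end Literature.AlgebraicGeometry.Motives

end
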